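import Literature.Topology.FourManifolds.ZeroSurgeryHomotopyBallSliceProofs
import Literature.AlgebraicTopology.SingularHomology.SphereComplementDegree
import Mathlib.Topology.Compactification.OnePoint.Sphere
import Mathlib.Analysis.Normed.Module.Ball.Homeomorph
import HarnessLib

/-!
# The open slice-disc exterior `B̊⁴ ∖ Δ` is a homology circle

For a slice disc `g` of a knot `K` (`Knot.IsSliceDisc K g`, `SliceRibbon.lean`: `g : ℝ² → ℝ⁴`
smooth, injective on `𝔻²`, open disc into the open ball, `g|∂𝔻² = K ⊂ S³`), the open slice-disc
exterior `sliceDiscExterior g = B̊⁴ ∖ g(𝔻²)` (`ZeroSurgeryHomotopyBallSliceProofs.lean`) is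
homeomorphic to the complement of a topologically embedded `2`-sphere in `S⁴`:
compactifying `B̊⁴ ≅ ℝ⁴` by one point, the properly embedded open disc `g(B̊²) ≅ ℝ²` closes up to
an embedded `S² = ℝ² ∪ {∞}` (`Knot.IsSliceDisc.exists_isEmbedding_sphere_two_homeomorph`; the map
`ℝ² → ℝ⁴`, `u ↦ β₄⁻¹ (g (β₂ u))` with `β : ℝⁿ ≃ₜ B̊ⁿ` Mathlib's `Homeomorph.unitBall`, is proper
because `‖g x‖ → 1` as `‖x‖ → 1`, so it extends to the one-point compactifications
`OnePoint ℝⁿ ≃ₜ Sⁿ`, Mathlib's `onePointEquivSphereOfFinrankEq`).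

Hence, by Hatcher's Prop. 2B.1(b) (`SphereComplement.isZero_compl_range_of_isEmbedding_holds`,
`SphereComplement.nonempty_compl_range_iso_coeff_of_isEmbedding`), for every coefficient module:

* `Knot.IsSliceDisc.isZero_singularHomology_sliceDiscExterior` — `Hᵢ(B̊⁴ ∖ Δ; M) = 0` for `i ≥ 2`;
* `Knot.IsSliceDisc.nonempty_singularHomology_sliceDiscExterior_one_iso` — `H₁(B̊⁴ ∖ Δ; M) ≅ M`.

This is the homological input "`H_*(V) ≅ H_*(B⁴ ∖ Δ) ≅ H_*(S¹)`" of the computation of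
`H₂(X(K') ∪ V)` in Manolescu–Piccirillo (2023), proof of Lemma 3.3 (Alexander duality for the
slice disc). Everything is proved; no named facts, no definitions.

## References

* C. Manolescu, L. Piccirillo, *From zero surgeries to candidates for exotic definite
  4-manifolds*, J. Lond. Math. Soc. 108 (2023), §3.2, proof of Lemma 3.3 [ManolescuPiccirillo2023].
* A. Hatcher, *Algebraic Topology*, CUP 2002, Prop. 2B.1(b) [HatcherAT2002].
-/

noncomputable section

open Set Function Metric Filter Topology CategoryTheory Limits
open Literature.AlgebraicTopology.SingularHomology

namespace Literature.Topology.FourManifolds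

namespace Knot.IsSliceDisc

variable {K : Knot} {g : EuclideanSpace ℝ (Fin 2) → EuclideanSpace ℝ (Fin 4)}

/-- A slice disc is continuous. [folklore] -/
theorem continuous (hg : K.IsSliceDisc g) : Continuous g := hg.1.continuous

/-- A slice disc maps the open disc into the open ball. [folklore] -/
theorem norm_lt_one (hg : K.IsSliceDisc g) {x : EuclideanSpace ℝ (Fin 2)} (hx : ‖x‖ < 1) :
    ‖g x‖ < 1 := hg.2.2.2.1 x hx

/-- A slice disc maps the boundary circle into the boundary sphere. [folklore] -/
theorem norm_eq_one (hg : K.IsSliceDisc g) {x : EuclideanSpace ℝ (Fin 2)} (hx : ‖x‖ = 1) :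
    ‖g x‖ = 1 := by
  have h := hg.2.2.2.2.2 ⟨x, mem_sphere_zero_iff_norm.2 hx⟩
  change g x = ((K ⟨x, _⟩ : Metric.sphere (0 : EuclideanSpace ℝ (Fin 4)) 1) : EuclideanSpace ℝ (Fin 4))
    at h
  rw [h]
  exact norm_eq_of_mem_sphere _

/-- A slice disc maps the closed disc into the closed ball. [folklore] -/
theorem norm_le_one (hg : K.IsSliceDisc g) {x : EuclideanSpace ℝ (Fin 2)} (hx : ‖x‖ ≤ 1) :
    ‖g x‖ ≤ 1 := by
  rcases hx.lt_or_eq with h | h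
  · exact (hg.norm_lt_one h).le
  · exact (hg.norm_eq_one h).le

/-- **Properness of the open slice disc**: the part of the closed disc mapped into the closed
ball of radius `ρ < 1` is a compact subset of the *open* disc (on the boundary circle `‖g‖ = 1`).
[folklore] -/
theorem isCompact_norm_le (hg : K.IsSliceDisc g) {ρ : ℝ} (hρ : ρ < 1) :
    IsCompact {x : EuclideanSpace ℝ (Fin 2) | ‖x‖ ≤ 1 ∧ ‖g x‖ ≤ ρ} ∧
      {x : EuclideanSpace ℝ (Fin 2) | ‖x‖ ≤ 1 ∧ ‖g x‖ ≤ ρ} ⊆ Metric.ball 0 1 := by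
  constructor
  · have hc : IsClosed {x : EuclideanSpace ℝ (Fin 2) | ‖x‖ ≤ 1 ∧ ‖g x‖ ≤ ρ} :=
      (isClosed_le continuous_norm continuous_const).inter
        (isClosed_le (continuous_norm.comp hg.continuous) continuous_const)
    refine (isCompact_closedBall (0 : EuclideanSpace ℝ (Fin 2)) 1).of_isClosed_subset hc ?_
    intro x hx
    exact mem_closedBall_zero_iff.2 hx.1
  · intro x hx
    rw [mem_ball_zero_iff]
    rcases hx.1.lt_or_eq with h | h
    · exact h
    · exact absurd (hg.norm_eq_one h) (by linarith [hx.2])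

/-- **The open slice disc closes up to an embedded `2`-sphere in `S⁴` whose complement is the
open slice-disc exterior** (Manolescu–Piccirillo 2023, proof of Lemma 3.3: `V` is a slice-disc
exterior; here in the one-point compactification `B̊⁴ ∪ {∞} ≅ S⁴`). For a slice disc `g` there is
a topological embedding `h : S² → S⁴` with `sliceDiscExterior g ≃ₜ S⁴ ∖ h(S²)`: `h` is the
extension to `OnePoint ℝ² ≅ S²`, `OnePoint ℝ⁴ ≅ S⁴` of the proper injection
`u ↦ β₄⁻¹ (g (β₂ u))`, `β : ℝⁿ ≃ₜ B̊ⁿ`. [cite: ManolescuPiccirillo2023, §3.2, proof of Lemma 3.3] -/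
theorem exists_isEmbedding_sphere_two_homeomorph (hg : K.IsSliceDisc g) :
    ∃ h : Metric.sphere (0 : EuclideanSpace ℝ (Fin 3)) 1 → Metric.sphere (0 : EuclideanSpace ℝ (Fin 5)) 1,
      IsEmbedding h ∧ Nonempty (sliceDiscExterior g ≃ₜ ↥((range h)ᶜ)) := by
  -- the homeomorphisms `ℝⁿ ≃ₜ B̊ⁿ` and `OnePoint ℝⁿ ≃ₜ Sⁿ`
  set β₂ : EuclideanSpace ℝ (Fin 2) ≃ₜ ↥(Metric.ball (0 : EuclideanSpace ℝ (Fin 2)) 1) :=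
    Homeomorph.unitBall with hβ₂
  set β₄ : EuclideanSpace ℝ (Fin 4) ≃ₜ ↥(Metric.ball (0 : EuclideanSpace ℝ (Fin 4)) 1) :=
    Homeomorph.unitBall with hβ₄
  let e₂ : OnePoint (EuclideanSpace ℝ (Fin 2)) ≃ₜ Metric.sphere (0 : EuclideanSpace ℝ (Fin 3)) 1 :=
    onePointEquivSphereOfFinrankEq (by simp)
  let e₄ : OnePoint (EuclideanSpace ℝ (Fin 4)) ≃ₜ Metric.sphere (0 : EuclideanSpace ℝ (Fin 5)) 1 :=
    onePointEquivSphereOfFinrankEq (by simp)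
  -- the proper injection `G u = β₄⁻¹ (g (β₂ u))`
  have hball : ∀ u : EuclideanSpace ℝ (Fin 2),
      g (β₂ u : EuclideanSpace ℝ (Fin 2)) ∈ Metric.ball (0 : EuclideanSpace ℝ (Fin 4)) 1 := fun u =>
    mem_ball_zero_iff.2 (hg.norm_lt_one (mem_ball_zero_iff.1 (β₂ u).2))
  let G : EuclideanSpace ℝ (Fin 2) → EuclideanSpace ℝ (Fin 4) := fun u => β₄.symm ⟨g (β₂ u), hball u⟩
  have hGc : Continuous G :=
    β₄.symm.continuous.comp ((hg.continuous.comp (continuous_subtype_val.comp β₂.continuous)).subtype_mk _)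
  have hGinj : Injective G := by
    intro u v huv
    have h1 : (⟨g (β₂ u), hball u⟩ : ↥(Metric.ball (0 : EuclideanSpace ℝ (Fin 4)) 1)) =
        ⟨g (β₂ v), hball v⟩ := β₄.symm.injective huv
    have h2 : g (β₂ u) = g (β₂ v) := congrArg Subtype.val h1
    have h3 : (β₂ u : EuclideanSpace ℝ (Fin 2)) = β₂ v :=
      hg.2.1 (ball_subset_closedBall (β₂ u).2) (ball_subset_closedBall (β₂ v).2) h2
    exact β₂.injective (Subtype.ext h3)
  -- properness: `G ⁻¹' K` is compact for `K` compact
  have hGproper : Tendsto G (cocompact _) (cocompact _) := by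
    rw [hasBasis_cocompact.tendsto_right_iff]
    intro T hT
    -- the compact set `β₄(T) ⊆ B̊⁴` has norm bounded by some `ρ < 1`
    set T' : Set (EuclideanSpace ℝ (Fin 4)) :=
      Subtype.val '' (β₄ '' T) with hT'
    have hT'c : IsCompact T' := (hT.image β₄.continuous).image continuous_subtype_val
    have hT'b : T' ⊆ Metric.ball 0 1 := by
      rintro _ ⟨y, -, rfl⟩
      exact y.2
    obtain ⟨ρ, hρ1, hρ⟩ : ∃ ρ : ℝ, ρ < 1 ∧ ∀ y ∈ T', ‖y‖ ≤ ρ := by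
      rcases T'.eq_empty_or_nonempty with h0 | hne
      · exact ⟨0, zero_lt_one, fun y hy => by simp [h0] at hy⟩
      · obtain ⟨y₀, hy₀, hmax⟩ := hT'c.exists_isMaxOn hne continuous_norm.continuousOn
        exact ⟨‖y₀‖, mem_ball_zero_iff.1 (hT'b hy₀), fun y hy => hmax hy⟩
    obtain ⟨hSc, hSb⟩ := hg.isCompact_norm_le hρ1
    -- the compact set `β₂⁻¹ {x ∈ B̊² | ‖g x‖ ≤ ρ}` contains `G ⁻¹' T`
    set S : Set ↥(Metric.ball (0 : EuclideanSpace ℝ (Fin 2)) 1) :=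
      Subtype.val ⁻¹' {x : EuclideanSpace ℝ (Fin 2) | ‖x‖ ≤ 1 ∧ ‖g x‖ ≤ ρ} with hS
    have hS' : IsCompact S := by
      rw [IsEmbedding.subtypeVal.isCompact_iff, hS, image_preimage_eq_inter_range,
        Subtype.range_coe, inter_eq_left.2 hSb]
      exact hSc
    refine Filter.mem_cocompact.2 ⟨β₂ ⁻¹' S, β₂.isCompact_preimage.2 hS', fun u hu => ?_⟩
    -- if `G u ∈ T` then `β₂ u ∈ S`
    change G u ∉ T
    intro hGu
    apply hu
    have h1 : (⟨g (β₂ u), hball u⟩ : ↥(Metric.ball (0 : EuclideanSpace ℝ (Fin 4)) 1)) ∈ β₄ '' T :=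
      ⟨G u, hGu, β₄.apply_symm_apply _⟩
    have h2 : g (β₂ u) ∈ T' := ⟨_, h1, rfl⟩
    exact ⟨(mem_ball_zero_iff.1 (β₂ u).2).le, hρ _ h2⟩
  have hGtend : Tendsto G (coclosedCompact _) (coclosedCompact _) := by
    rwa [Filter.coclosedCompact_eq_cocompact, Filter.coclosedCompact_eq_cocompact]
  -- the embedding `h = e₄ ∘ OnePoint.map G ∘ e₂⁻¹`
  let h : Metric.sphere (0 : EuclideanSpace ℝ (Fin 3)) 1 → Metric.sphere (0 : EuclideanSpace ℝ (Fin 5)) 1 :=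
    fun s => e₄ (OnePoint.map G (e₂.symm s))
  have hhc : Continuous h :=
    e₄.continuous.comp ((OnePoint.continuous_map hGc hGtend).comp e₂.symm.continuous)
  have hmapinj : Injective (OnePoint.map G) := Option.map_injective hGinj
  have hhinj : Injective h := fun s t hst =>
    e₂.symm.injective (hmapinj (e₄.injective hst))
  have hhe : IsEmbedding h := (hhc.isClosedEmbedding hhinj).isEmbedding
  -- points of the form `e₄ ↑u` with `u ∉ range G` are exactly the complement of `range h`
  have hrange : ∀ q : OnePoint (EuclideanSpace ℝ (Fin 4)), e₄ q ∈ range h ↔ q ∈ range (OnePoint.map G) := by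
    intro q
    constructor
    · rintro ⟨s, hs⟩
      exact ⟨e₂.symm s, e₄.injective hs⟩
    · rintro ⟨p, rfl⟩
      exact ⟨e₂ p, by simp [h]⟩
  have hcoe_range : ∀ u : EuclideanSpace ℝ (Fin 4),
      (↑u : OnePoint (EuclideanSpace ℝ (Fin 4))) ∈ range (OnePoint.map G) ↔ u ∈ range G := by
    intro u
    constructor
    · rintro ⟨p, hp⟩
      induction p using OnePoint.rec with
      | infty => exact absurd hp (by simp)
      | coe v => exact ⟨v, by simpa using hp⟩
    · rintro ⟨v, rfl⟩
      exact ⟨↑v, rfl⟩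
  have hG_range : ∀ u : EuclideanSpace ℝ (Fin 4), u ∈ range G ↔
      (β₄ u : EuclideanSpace ℝ (Fin 4)) ∈ g '' Metric.closedBall 0 1 := by
    intro u
    constructor
    · rintro ⟨v, rfl⟩
      refine ⟨β₂ v, ball_subset_closedBall (β₂ v).2, ?_⟩
      change g (β₂ v) = (β₄ (β₄.symm ⟨g (β₂ v), hball v⟩) : EuclideanSpace ℝ (Fin 4))
      rw [β₄.apply_symm_apply]
    · rintro ⟨x, hx, hxu⟩
      have hx1 : ‖x‖ < 1 := by
        rcases (mem_closedBall_zero_iff.1 hx).lt_or_eq with h1 | h1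
        · exact h1
        · have := hg.norm_eq_one h1
          rw [hxu] at this
          exact absurd this (ne_of_lt (mem_ball_zero_iff.1 (β₄ u).2))
      refine ⟨β₂.symm ⟨x, mem_ball_zero_iff.2 hx1⟩, ?_⟩
      change β₄.symm ⟨g (β₂ (β₂.symm ⟨x, _⟩)), _⟩ = u
      rw [← β₄.symm_apply_apply u]
      congr 1
      apply Subtype.ext
      simp [hxu]
  -- the homeomorphism `sliceDiscExterior g ≃ₜ (range h)ᶜ`
  have hclos : closure (g '' Metric.closedBall (0 : EuclideanSpace ℝ (Fin 2)) 1) =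
      g '' Metric.closedBall 0 1 :=
    ((isCompact_closedBall _ _).image hg.continuous).isClosed.closure_eq
  set cE : EuclideanSpace ℝ (Fin 4) ≃ₜ
      ↥(range ((↑) : EuclideanSpace ℝ (Fin 4) → OnePoint (EuclideanSpace ℝ (Fin 4)))) :=
    OnePoint.isOpenEmbedding_coe.isEmbedding.toHomeomorph with hcE
  -- forward map
  have hy1 : ∀ y : sliceDiscExterior g, (y.1 : EuclideanSpace ℝ (Fin 4)) ∈ Metric.ball (0 : EuclideanSpace ℝ (Fin 4)) 1 :=
    fun y => mem_ball_zero_iff.2 (mem_sliceDiscExterior_iff.1 y.2).1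
  have hfwd_mem : ∀ y : sliceDiscExterior g,
      e₄ (↑(β₄.symm ⟨y.1, hy1 y⟩) : OnePoint (EuclideanSpace ℝ (Fin 4))) ∈ (range h)ᶜ := by
    intro y
    rw [mem_compl_iff, hrange, hcoe_range, hG_range, β₄.apply_symm_apply]
    exact fun hmem => (mem_sliceDiscExterior_iff.1 y.2).2 (subset_closure hmem)
  -- backward map: a point off `range h` is `e₄ ↑u` with `u ∉ range G`
  have hbwd_ne : ∀ p : ↥((range h)ᶜ), e₄.symm p.1 ≠ OnePoint.infty := by
    intro p hp
    apply p.2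
    rw [← e₄.apply_symm_apply p.1, hrange, hp]
    exact ⟨OnePoint.infty, rfl⟩
  have hbwd_range : ∀ p : ↥((range h)ᶜ),
      e₄.symm p.1 ∈ range ((↑) : EuclideanSpace ℝ (Fin 4) → OnePoint (EuclideanSpace ℝ (Fin 4))) := by
    intro p
    exact OnePoint.ne_infty_iff_exists.1 (hbwd_ne p) |>.imp fun u hu => hu
  have hcE_symm : ∀ (q : OnePoint (EuclideanSpace ℝ (Fin 4)))
      (hq : q ∈ range ((↑) : EuclideanSpace ℝ (Fin 4) → OnePoint (EuclideanSpace ℝ (Fin 4))))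
      (v : EuclideanSpace ℝ (Fin 4)), q = ↑v → cE.symm ⟨q, hq⟩ = v := by
    rintro q hq v rfl
    rw [hcE]
    exact IsEmbedding.toHomeomorph_symm_apply _ v
  have hbwd_coe : ∀ p : ↥((range h)ᶜ),
      (↑(cE.symm ⟨e₄.symm p.1, hbwd_range p⟩) : OnePoint (EuclideanSpace ℝ (Fin 4))) = e₄.symm p.1 := by
    intro p
    obtain ⟨v, hv⟩ := hbwd_range p
    rw [hcE_symm _ (hbwd_range p) v hv.symm, hv]
  have hbwd_mem : ∀ p : ↥((range h)ᶜ),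
      (β₄ (cE.symm ⟨e₄.symm p.1, hbwd_range p⟩) : EuclideanSpace ℝ (Fin 4)) ∈ sliceDiscExterior g := by
    intro p
    rw [mem_sliceDiscExterior_iff, hclos, ← hG_range, ← hcoe_range, hbwd_coe, ← hrange,
      e₄.apply_symm_apply]
    exact ⟨mem_ball_zero_iff.1 (β₄ _).2, p.2⟩
  -- the two maps and the homeomorphism
  let F : sliceDiscExterior g → ↥((range h)ᶜ) := fun y => ⟨e₄ ↑(β₄.symm ⟨y.1, hy1 y⟩), hfwd_mem y⟩
  let Finv : ↥((range h)ᶜ) → sliceDiscExterior g := fun p =>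
    ⟨(β₄ (cE.symm ⟨e₄.symm p.1, hbwd_range p⟩) : EuclideanSpace ℝ (Fin 4)), hbwd_mem p⟩
  have hleft : ∀ y, Finv (F y) = y := by
    intro y
    apply Subtype.ext
    show (β₄ (cE.symm ⟨e₄.symm (e₄ ↑(β₄.symm ⟨y.1, hy1 y⟩)), hbwd_range (F y)⟩) :
      EuclideanSpace ℝ (Fin 4)) = y.1
    rw [hcE_symm _ (hbwd_range (F y)) (β₄.symm ⟨y.1, hy1 y⟩) (e₄.symm_apply_apply _),
      β₄.apply_symm_apply]
  have hright : ∀ p, F (Finv p) = p := by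
    intro p
    apply Subtype.ext
    show e₄ ↑(β₄.symm ⟨(β₄ (cE.symm ⟨e₄.symm p.1, hbwd_range p⟩) : EuclideanSpace ℝ (Fin 4)),
      hy1 (Finv p)⟩) = p.1
    have h3 : (⟨(β₄ (cE.symm ⟨e₄.symm p.1, hbwd_range p⟩) : EuclideanSpace ℝ (Fin 4)), hy1 (Finv p)⟩ :
        ↥(Metric.ball (0 : EuclideanSpace ℝ (Fin 4)) 1)) = β₄ (cE.symm ⟨e₄.symm p.1, hbwd_range p⟩) :=
      Subtype.ext rfl
    rw [h3, β₄.symm_apply_apply, hbwd_coe, e₄.apply_symm_apply]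
  have hFc : Continuous F := by
    refine Continuous.subtype_mk ?_ _
    refine e₄.continuous.comp (OnePoint.continuous_coe.comp (β₄.symm.continuous.comp ?_))
    exact continuous_subtype_val.subtype_mk _
  have hFinvc : Continuous Finv := by
    refine Continuous.subtype_mk ?_ _
    refine continuous_subtype_val.comp (β₄.continuous.comp (cE.symm.continuous.comp ?_))
    exact (e₄.symm.continuous.comp continuous_subtype_val).subtype_mk _
  exact ⟨h, hhe, ⟨⟨⟨F, Finv, hleft, hright⟩, hFc, hFinvc⟩⟩⟩

/-- **The open slice-disc exterior has no homology in degrees `≥ 2`**: `Hᵢ(B̊⁴ ∖ Δ; M) = 0` for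
`i ≥ 2` and every coefficient module (it is `S⁴ ∖ h(S²)` for a topological embedding `h`, and
Hatcher's Prop. 2B.1(b) gives `H̃ᵢ = 0` for `i ≠ 4 - 2 - 1 = 1`). This is "`H₂(V) = 0`" in the
homology computation of Manolescu–Piccirillo (2023), proof of Lemma 3.3.
[cite: HatcherAT2002, Prop. 2B.1(b)] -/
theorem isZero_singularHomology_sliceDiscExterior (hg : K.IsSliceDisc g) (R : Type) [CommRing R]
    (M : Type) [AddCommGroup M] [Module R M] {i : ℕ} (hi : 2 ≤ i) :
    IsZero (singularHomology R M (sliceDiscExterior g) i) := by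
  obtain ⟨h, he, ⟨Φ⟩⟩ := hg.exists_isEmbedding_sphere_two_homeomorph
  have hz := SphereComplement.isZero_compl_range_of_isEmbedding_holds R M (k := 2) (n := 4) (i := i)
    h he (by norm_num) (by omega) (by omega)
  exact hz.of_iso (singularHomology.mapIso R M Φ i)

/-- **`H₁` of the open slice-disc exterior is the coefficient module**: `H₁(B̊⁴ ∖ Δ; M) ≅ M` (it is
`S⁴ ∖ h(S²)`, Hatcher's Prop. 2B.1(b) in the degree `4 - 2 - 1 = 1`,
`SphereComplement.nonempty_compl_range_iso_coeff_of_isEmbedding`). This is "`H₁(V) ≅ ℤ`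
(generated by the meridian of `Δ`)" in Manolescu–Piccirillo (2023), proof of Lemma 3.3.
[cite: HatcherAT2002, Prop. 2B.1(b)] -/
theorem nonempty_singularHomology_sliceDiscExterior_one_iso (hg : K.IsSliceDisc g) (R : Type)
    [CommRing R] (M : Type) [AddCommGroup M] [Module R M] :
    Nonempty (singularHomology R M (sliceDiscExterior g) 1 ≅ ModuleCat.of R (ULift M)) := by
  obtain ⟨h, he, ⟨Φ⟩⟩ := hg.exists_isEmbedding_sphere_two_homeomorph
  obtain ⟨e⟩ := SphereComplement.nonempty_compl_range_iso_coeff_of_isEmbedding R M (k := 2) (m := 3)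
    h he (by norm_num)
  exact ⟨singularHomology.mapIso R M Φ 1 ≪≫ e⟩

end Knot.IsSliceDisc

end Literature.Topology.FourManifolds
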